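import Summits.QuantumFields.YangMills.Theorems.VirialFluxGapResolventFieldHessFrameDeriv
import Summits.QuantumFields.YangMills.Theorems.VirialFluxGapFixChart
import Summits.QuantumFields.YangMills.Theorems.VirialFluxGapSheetKernelFix
import HarnessLib

/-!
# Route `VirialFluxGap` (YangMills): the RESOLVENT EULER FIELD on the tree-gauged host `X_fix` — the GENERIC-REGION POINTWISE PACKAGE
# (E1) driving + (E2) divergence at every regular small-deficit point, constants explicit in `L, ρ, K, λ⋆, η`, in w2's frame family `fixFrameStd`

Toward the deciding crux `VirialFluxGap.PeriodicSoftness` (item stmt-QuantumFields-24141), generic-region Euler field `X_g = ½(H+λ⋆)⁻¹g`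
(memo `fcl-p3-g40-RESOLVENT-EULER-FIELD-24141.md`; LEAD ruling 2026-08-30T23:30:33Z: host = `X_fix`).  This file INSTANTIATES the master
estimates ✓`generic_drive_lower` ∕ ✓`generic_divergence_upper` at a point `P` of `X_fix` (slice-0 tree links `1`) that is `ρ`-regular with
`224L²√F₀(P) < ρ`, with ALL geometric inputs discharged from the tree: the chart and base point (w2 ✓`FixFrame.exists_fixChart_of_regular`:
`u`, comb zero `p = P·exp(Y_u)`, `|u|² ≤ 1032960L⁸F₀(P)/ρ²`), the four orthonormal sheet kernel vectors at `p` (w2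
✓`FixFrame.exists_four_orthonormal_kernel_vectors`), the unit slot norms (✓`norm_fixFrameStd_le`), the `hB` bound (✓`frameHess_frameDeriv_sq_le`,
`b = #ι·K`).  What stays a hypothesis: the frame-free trilinear constant `K` (take `K = C·L⁴` from ✓`exists_bound_frameD3_ringPoly`), the
parameters `λ⋆ > 0`, `0 < η < 1`, and ONE smallness `K·#ι·√(#ι·D) ≤ λ⋆/2` with `D = 1032960L⁸F₀(P)/ρ²`.

* ★★★ `fix_generic_drive_lower` (E1): `(1 − η − (3K#ι^{3/2}√D + λ⋆/2 + 4K²#ι³D/(ηλ⋆))·1032960L⁸/ρ²)·F₀(P) ≤ ½gᵀ(H+λ⋆)⁻¹g`;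
* ★★★ `fix_generic_divergence_upper` (E2): `½tr(A⁻¹H) − ½Σ_i(A⁻¹B_iA⁻¹g)_i ≤ ½(#ι − 4) + 2·s̄/(s̄+λ⋆) + ½#ι(#ιK/(λ⋆/2))√(3(5D + (2K#ι^{3/2})²D²/(λ⋆/2)²))`,
  `s̄ = K#ι√(#ιD)`, `#ι = 18L⁴ + 3` (✓`card_fixVar_mul_three`), all at `ringCoord P`, `τ = fixFrameStd`.

So on the generic region the field `2X_g` has divergence `≤ 18L⁴ − 1 + o(1)` and drive `≥ 2(1 − o(1))F₀` once `λ⋆, D` are polynomially small —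
the two clauses of «EulerFieldFix» there.  HONEST LABEL: pointwise package only; cut-offs, the central charts (w3) and the patching are NOT here;
the Euler field is NOT assembled; ⟨24141⟩, ⟨22884⟩ remain OPEN; the Yang–Mills mass gap is NOT proved; no summit is proved by a line.
THEOREMS ONLY (0 `def`, 0 `sorry`), standard axioms.  Explicit-unit seat `ym-line-fcl-p3` g40 (cell ym-idea-1, free hands),
`--supports stmt-QuantumFields-24141`.  References: [cite: Luscher1983, §2]; [folklore].
-/

set_option autoImplicit false

noncomputable section

open scoped Matrix BigOperators ContDiff Topology Quaternion
open MeasureTheory Set Matrix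
open Literature.MathematicalPhysics.QuantumFieldTheory hiding SU2
open Literature.MathematicalPhysics.QuantumLattice
open Literature.MathematicalPhysics.QuantumFieldTheory.SUNBakryEmery (expSU coe_expSU matTop)

namespace Summit.QuantumFields.YangMills.Theorems.VirialFluxGap.FrameHessian

open Summit.QuantumFields.YangMills.Theorems.FemtoTransferGap
open Summit.QuantumFields.YangMills.Theorems.FemtoTransferGap.TT
open Summit.QuantumFields.YangMills.Theorems.FemtoTransferGap.TwoLattice
open Summit.QuantumFields.YangMills.Theorems.FemtoTransferGap.TwoLattice.Flat
open Summit.QuantumFields.YangMills.Theorems.VirialFluxGap.RingDeficit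
open Summit.QuantumFields.YangMills.Theorems.VirialFluxGap.FrameDerivative
open Summit.QuantumFields.YangMills.Theorems.VirialFluxGap.ResolventField
open Summit.QuantumFields.YangMills.Theorems.VirialFluxGap.RegularValley
open Summit.QuantumFields.YangMills.Theorems.VirialFluxGap.FixFrame

variable {L : ℕ} [NeZero L]

open scoped Matrix.Norms.Frobenius

attribute [local instance 2000] Literature.MathematicalPhysics.QuantumFieldTheory.SUNBakryEmery.matTop

/-! ## §1 Two monotonicity letters -/

omit [NeZero L] in
/-- `s ↦ s/(s+λ)` is monotone on `[0,∞)` for `λ > 0`. [folklore] -/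
theorem div_add_mono {s s' lam : ℝ} (hs : 0 ≤ s) (hss' : s ≤ s') (hlam : 0 < lam) : s / (s + lam) ≤ s' / (s' + lam) := by
  rw [div_le_div_iff₀ (by linarith) (by linarith)]
  nlinarith

omit [NeZero L] in
/-- `ℓ¹ ≤ √(#ι·D)` when `|u|² ≤ D`. [folklore] -/
theorem sum_abs_le_sqrt {ι : Type*} [Fintype ι] (u : ι → ℝ) {D : ℝ} (huD : u ⬝ᵥ u ≤ D) :
    ∑ j, |u j| ≤ Real.sqrt (Fintype.card ι * D) := by
  have h1 := sum_abs_sq_le u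
  have h0 : 0 ≤ ∑ j, |u j| := Finset.sum_nonneg fun j _ => abs_nonneg _
  have h2 : (∑ j, |u j|) ^ 2 ≤ Fintype.card ι * D := h1.trans (mul_le_mul_of_nonneg_left huD (Nat.cast_nonneg _))
  calc ∑ j, |u j| = Real.sqrt ((∑ j, |u j|) ^ 2) := (Real.sqrt_sq h0).symm
    _ ≤ Real.sqrt (Fintype.card ι * D) := Real.sqrt_le_sqrt h2

/-! ## §2 The pointwise package on the generic region of `X_fix` -/

/-- ★★★ **(E1) on `X_fix`, generic region.**  At a slice-0 comb-gauged, `ρ`-regular ring history `P` with `224L²√F₀(P) < ρ`, for the frame family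
`fixFrameStd`, any trilinear third-derivative constant `K`, `λ⋆ > 0`, `0 < η < 1` and the smallness `K·√(#ι·D)·#ι ≤ λ⋆/2`
(`D = 1032960L⁸F₀(P)/ρ²`): `(1 − η − (3K#ι^{3/2}√D + λ⋆/2 + 4K²#ι³D/(ηλ⋆))/(ρ²/(1032960L⁸)))·F₀(P) ≤ ½gᵀ(H+λ⋆)⁻¹g`. [cite: Luscher1983, §2] -/
theorem fix_generic_drive_lower [DecidableEq (FixVar L × Fin 3)] (P : ((Fin (2 * L - 1 + 1) → GaugeConfig 3 L SU2) × (Site 3 L → SU2))) (hP : ∀ e : Edge 3 L, treeEdge e = true → P.1 0 e = 1) {ρ : ℝ} (hρ : 0 < ρ)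
    (hfar : (∃ k : Fin 3, ρ ^ 2 ≤ 1 - (su2Quat (wrapReps (P.1 0) k)).re ^ 2) ∨ ρ ^ 2 ≤ 1 - (su2Quat (P.2 0)).re ^ 2)
    (hsmall : 224 * (L : ℝ) ^ 2 * Real.sqrt (ringDeficit L (fun _ => false) P) < ρ)
    {K lam η : ℝ} (hK : 0 ≤ K) (hlam : 0 < lam) (hη : 0 < η) (hη1 : η < 1)
    (hK3 : ∀ (Y₁ Y₂ Y₃ : ((Fin (2 * L - 1 + 1) × Edge 3 L) ⊕ Site 3 L) → Matrix (Fin 2) (Fin 2) ℂ) (b₁ b₂ b₃ : ℝ), 0 ≤ b₁ → 0 ≤ b₂ → 0 ≤ b₃ →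
      (∀ w, ‖Y₁ w‖ ≤ b₁) → (∀ w, ‖Y₂ w‖ ≤ b₂) → (∀ w, ‖Y₃ w‖ ≤ b₃) → ∀ Q : ((Fin (2 * L - 1 + 1) → GaugeConfig 3 L SU2) × (Site 3 L → SU2)),
      |frameD Y₁ (frameD Y₂ (frameD Y₃ (ringPoly L))) (ringCoord L Q)| ≤ K * b₁ * b₂ * b₃)
    (hsmall2 : K * Real.sqrt (Fintype.card (FixVar L × Fin 3) * (1032960 * (L : ℝ) ^ 8 * ringDeficit L (fun _ => false) P / ρ ^ 2)) *
      Fintype.card (FixVar L × Fin 3) ≤ lam / 2) :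
    (1 - η - (3 * K * ((Fintype.card (FixVar L × Fin 3) : ℝ) * Real.sqrt (Fintype.card (FixVar L × Fin 3))) *
          Real.sqrt (1032960 * (L : ℝ) ^ 8 * ringDeficit L (fun _ => false) P / ρ ^ 2) + lam / 2 +
        4 * K ^ 2 * (Fintype.card (FixVar L × Fin 3) : ℝ) ^ 3 * (1032960 * (L : ℝ) ^ 8 * ringDeficit L (fun _ => false) P / ρ ^ 2) / (η * lam)) /
        (ρ ^ 2 / (1032960 * (L : ℝ) ^ 8))) * ringDeficit L (fun _ => false) P ≤
      (1 / 2) * (frameGrad (L := L) fixFrameStd (ringCoord L P) ⬝ᵥ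
        ((frameHess (L := L) fixFrameStd (ringCoord L P) + lam • (1 : Matrix (FixVar L × Fin 3) (FixVar L × Fin 3) ℝ))⁻¹ *ᵥ
          frameGrad (L := L) fixFrameStd (ringCoord L P))) := by
  classical
  obtain ⟨n₁, n₂, n₃, th, tc, h', c', u, hn, hh', hc', hp0, hPu, huu⟩ := exists_fixChart_of_regular P hP hρ hfar hsmall
  set F := ringDeficit L (fun _ => false) P with hF
  set D := 1032960 * (L : ℝ) ^ 8 * F / ρ ^ 2 with hD
  set c : ℝ := (Fintype.card (FixVar L × Fin 3) : ℝ) with hc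
  have hF0 : 0 ≤ F := ringDeficit_nonneg _ _
  have hL0 : (0 : ℝ) < L := by exact_mod_cast NeZero.pos L
  have hD0 : 0 ≤ D := by rw [hD]; positivity
  have hc0 : 0 ≤ c := Nat.cast_nonneg _
  have huD : u ⬝ᵥ u ≤ D := huu
  have hκ : 0 < ρ ^ 2 / (1032960 * (L : ℝ) ^ 8) := by positivity
  have hp : ringDeficit L (fun _ => false) (P * multiCurve (dirOf fixFrameStd u) (dirOf_conjTranspose fixFrameStd_conjTranspose u)
      (dirOf_trace fixFrameStd_trace u) 1) = 0 := by rw [hPu]; exact hp0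
  have hqg : ρ ^ 2 / (1032960 * (L : ℝ) ^ 8) * (u ⬝ᵥ u) ≤ F := by
    calc ρ ^ 2 / (1032960 * (L : ℝ) ^ 8) * (u ⬝ᵥ u) ≤ ρ ^ 2 / (1032960 * (L : ℝ) ^ 8) * D := mul_le_mul_of_nonneg_left huD hκ.le
      _ = F := by rw [hD]; field_simp
  have hl1 : ∑ j, |u j| ≤ Real.sqrt (c * D) := sum_abs_le_sqrt u huD
  have hl0 : 0 ≤ ∑ j, |u j| := Finset.sum_nonneg fun j _ => abs_nonneg _
  have hsm : K * (∑ j, |u j|) * Fintype.card (FixVar L × Fin 3) ≤ lam / 2 :=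
    le_trans (mul_le_mul_of_nonneg_right (mul_le_mul_of_nonneg_left hl1 hK) hc0) hsmall2
  have key := generic_drive_lower (L := L) (τ := fixFrameStd) fixFrameStd_conjTranspose fixFrameStd_trace norm_fixFrameStd_le u P hp hK hκ
    hlam hη hη1 hK3 hqg hsm
  -- weaken the `u`-dependent error terms to `D`
  have hsq : Real.sqrt (u ⬝ᵥ u) ≤ Real.sqrt D := Real.sqrt_le_sqrt huD
  have hX : 3 * K * (c * Real.sqrt c) * Real.sqrt (u ⬝ᵥ u) + lam / 2 + 4 * K ^ 2 * c ^ 3 * (u ⬝ᵥ u) / (η * lam) ≤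
      3 * K * (c * Real.sqrt c) * Real.sqrt D + lam / 2 + 4 * K ^ 2 * c ^ 3 * D / (η * lam) := by
    have h1 : 3 * K * (c * Real.sqrt c) * Real.sqrt (u ⬝ᵥ u) ≤ 3 * K * (c * Real.sqrt c) * Real.sqrt D :=
      mul_le_mul_of_nonneg_left hsq (by positivity)
    have h2 : 4 * K ^ 2 * c ^ 3 * (u ⬝ᵥ u) / (η * lam) ≤ 4 * K ^ 2 * c ^ 3 * D / (η * lam) :=
      div_le_div_of_nonneg_right (mul_le_mul_of_nonneg_left huD (by positivity)) (by positivity)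
    linarith
  have hcoef : (1 - η - (3 * K * (c * Real.sqrt c) * Real.sqrt D + lam / 2 + 4 * K ^ 2 * c ^ 3 * D / (η * lam)) /
        (ρ ^ 2 / (1032960 * (L : ℝ) ^ 8))) ≤
      (1 - η - (3 * K * (c * Real.sqrt c) * Real.sqrt (u ⬝ᵥ u) + lam / 2 + 4 * K ^ 2 * c ^ 3 * (u ⬝ᵥ u) / (η * lam)) /
        (ρ ^ 2 / (1032960 * (L : ℝ) ^ 8))) := by
    have := div_le_div_of_nonneg_right hX hκ.le
    linarith
  exact le_trans (mul_le_mul_of_nonneg_right hcoef hF0) key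

/-- ★★★ **(E2) on `X_fix`, generic region.**  Same point and data as ✓`fix_generic_drive_lower`; with the four orthonormal sheet kernel vectors
at the comb base point and `B_i = ∂_{τ_i}H` (`b = #ι·K`):
`½tr(A⁻¹H) − ½Σ_i(A⁻¹B_iA⁻¹g)_i ≤ ½(#ι − 4) + ½·4·s̄/(s̄+λ⋆) + ½#ι·(#ιK/(λ⋆/2))·√(3((1+λ⋆²/(λ⋆/2)²)D + (2K#ι^{3/2})²D²/(λ⋆/2)²))`,
`s̄ = K√(#ιD)#ι`. [cite: Luscher1983, §2] -/
theorem fix_generic_divergence_upper [DecidableEq (FixVar L × Fin 3)] (P : ((Fin (2 * L - 1 + 1) → GaugeConfig 3 L SU2) × (Site 3 L → SU2))) (hP : ∀ e : Edge 3 L, treeEdge e = true → P.1 0 e = 1) {ρ : ℝ} (hρ : 0 < ρ)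
    (hfar : (∃ k : Fin 3, ρ ^ 2 ≤ 1 - (su2Quat (wrapReps (P.1 0) k)).re ^ 2) ∨ ρ ^ 2 ≤ 1 - (su2Quat (P.2 0)).re ^ 2)
    (hsmall : 224 * (L : ℝ) ^ 2 * Real.sqrt (ringDeficit L (fun _ => false) P) < ρ)
    {K lam : ℝ} (hK : 0 ≤ K) (hlam : 0 < lam)
    (hK3 : ∀ (Y₁ Y₂ Y₃ : ((Fin (2 * L - 1 + 1) × Edge 3 L) ⊕ Site 3 L) → Matrix (Fin 2) (Fin 2) ℂ) (b₁ b₂ b₃ : ℝ), 0 ≤ b₁ → 0 ≤ b₂ → 0 ≤ b₃ →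
      (∀ w, ‖Y₁ w‖ ≤ b₁) → (∀ w, ‖Y₂ w‖ ≤ b₂) → (∀ w, ‖Y₃ w‖ ≤ b₃) → ∀ Q : ((Fin (2 * L - 1 + 1) → GaugeConfig 3 L SU2) × (Site 3 L → SU2)),
      |frameD Y₁ (frameD Y₂ (frameD Y₃ (ringPoly L))) (ringCoord L Q)| ≤ K * b₁ * b₂ * b₃)
    (hsmall2 : K * Real.sqrt (Fintype.card (FixVar L × Fin 3) * (1032960 * (L : ℝ) ^ 8 * ringDeficit L (fun _ => false) P / ρ ^ 2)) *
      Fintype.card (FixVar L × Fin 3) ≤ lam / 2) :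
    (1 / 2) * Matrix.trace ((frameHess (L := L) fixFrameStd (ringCoord L P) + lam • (1 : Matrix (FixVar L × Fin 3) (FixVar L × Fin 3) ℝ))⁻¹ *
          frameHess (L := L) fixFrameStd (ringCoord L P)) -
        (1 / 2) * ∑ i, ((frameHess (L := L) fixFrameStd (ringCoord L P) + lam • (1 : Matrix (FixVar L × Fin 3) (FixVar L × Fin 3) ℝ))⁻¹ *ᵥ
          ((fun j' k => frameD (fixFrameStd i) (fun M => frameHess (L := L) fixFrameStd M j' k) (ringCoord L P)) *ᵥ
            ((frameHess (L := L) fixFrameStd (ringCoord L P) + lam • (1 : Matrix (FixVar L × Fin 3) (FixVar L × Fin 3) ℝ))⁻¹ *ᵥ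
              frameGrad (L := L) fixFrameStd (ringCoord L P)))) i ≤
      (1 / 2) * ((Fintype.card (FixVar L × Fin 3) : ℝ) - 4) +
        (1 / 2) * (4 * ((K * Real.sqrt (Fintype.card (FixVar L × Fin 3) * (1032960 * (L : ℝ) ^ 8 * ringDeficit L (fun _ => false) P / ρ ^ 2)) *
            Fintype.card (FixVar L × Fin 3)) /
          (K * Real.sqrt (Fintype.card (FixVar L × Fin 3) * (1032960 * (L : ℝ) ^ 8 * ringDeficit L (fun _ => false) P / ρ ^ 2)) *
            Fintype.card (FixVar L × Fin 3) + lam))) +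
        (1 / 2) * ((Fintype.card (FixVar L × Fin 3) : ℝ) * (((Fintype.card (FixVar L × Fin 3) : ℝ) * K) / (lam / 2)) *
          Real.sqrt (3 * ((1 + lam ^ 2 / (lam / 2) ^ 2) * (1032960 * (L : ℝ) ^ 8 * ringDeficit L (fun _ => false) P / ρ ^ 2) +
            (2 * K * (Fintype.card (FixVar L × Fin 3) : ℝ) * Real.sqrt (Fintype.card (FixVar L × Fin 3))) ^ 2 *
              (1032960 * (L : ℝ) ^ 8 * ringDeficit L (fun _ => false) P / ρ ^ 2) ^ 2 / (lam / 2) ^ 2))) := by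
  classical
  obtain ⟨n₁, n₂, n₃, th, tc, h', c', u, hn, hh', hc', hp0, hPu, huu⟩ := exists_fixChart_of_regular P hP hρ hfar hsmall
  set F := ringDeficit L (fun _ => false) P with hF
  set D := 1032960 * (L : ℝ) ^ 8 * F / ρ ^ 2 with hD
  set c : ℝ := (Fintype.card (FixVar L × Fin 3) : ℝ) with hc
  have hF0 : 0 ≤ F := ringDeficit_nonneg _ _
  have hL0 : (0 : ℝ) < L := by exact_mod_cast NeZero.pos L
  have hD0 : 0 ≤ D := by rw [hD]; positivity
  have hc0 : 0 ≤ c := Nat.cast_nonneg _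
  have huD : u ⬝ᵥ u ≤ D := huu
  have hp : ringDeficit L (fun _ => false) (P * multiCurve (dirOf fixFrameStd u) (dirOf_conjTranspose fixFrameStd_conjTranspose u)
      (dirOf_trace fixFrameStd_trace u) 1) = 0 := by rw [hPu]; exact hp0
  have hl1 : ∑ j, |u j| ≤ Real.sqrt (c * D) := sum_abs_le_sqrt u huD
  have hl0 : 0 ≤ ∑ j, |u j| := Finset.sum_nonneg fun j _ => abs_nonneg _
  have hsm : K * (∑ j, |u j|) * Fintype.card (FixVar L × Fin 3) ≤ lam / 2 :=
    le_trans (mul_le_mul_of_nonneg_right (mul_le_mul_of_nonneg_left hl1 hK) hc0) hsmall2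
  -- the four orthonormal sheet kernel vectors at the comb base point
  have hn0 : 0 < n₁ ^ 2 + n₂ ^ 2 + n₃ ^ 2 := by rw [hn]; exact one_pos
  obtain ⟨k, hon, hkraw, -⟩ := exists_four_orthonormal_kernel_vectors (L := L) n₁ n₂ n₃ hn0 hh' hc'
  have hker : ∀ a, frameHessRaw (L := L) fixFrameStd (ringCoord L (P * multiCurve (dirOf fixFrameStd u)
      (dirOf_conjTranspose fixFrameStd_conjTranspose u) (dirOf_trace fixFrameStd_trace u) 1)) *ᵥ k a = 0 := by
    intro a; rw [hPu]; exact hkraw a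
  have hb : 0 ≤ c * K := mul_nonneg hc0 hK
  have hB := fun i v => frameHess_frameDeriv_sq_le (L := L) (τ := fixFrameStd) norm_fixFrameStd_le hK hK3 P i v
  have key := generic_divergence_upper (L := L) (τ := fixFrameStd) fixFrameStd_conjTranspose fixFrameStd_trace norm_fixFrameStd_le u P hp
    hK hlam hK3 hsm k hon hker (fun i => fun j' k => frameD (fixFrameStd i) (fun M => frameHess (L := L) fixFrameStd M j' k) (ringCoord L P))
    hb hB
  -- weaken the `u`-dependent terms to `D`
  set s := K * (∑ j, |u j|) * Fintype.card (FixVar L × Fin 3) with hs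
  set s' := K * Real.sqrt (c * D) * Fintype.card (FixVar L × Fin 3) with hs'
  have hs0 : 0 ≤ s := by rw [hs]; positivity
  have hss' : s ≤ s' := mul_le_mul_of_nonneg_right (mul_le_mul_of_nonneg_left hl1 hK) hc0
  have h1 : s / (s + lam) ≤ s' / (s' + lam) := div_add_mono hs0 hss' hlam
  have huu0 : 0 ≤ u ⬝ᵥ u := dpnn u
  have h2 : Real.sqrt (3 * ((1 + lam ^ 2 / (lam / 2) ^ 2) * (u ⬝ᵥ u) + (2 * K * c * Real.sqrt c) ^ 2 * (u ⬝ᵥ u) ^ 2 / (lam / 2) ^ 2)) ≤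
      Real.sqrt (3 * ((1 + lam ^ 2 / (lam / 2) ^ 2) * D + (2 * K * c * Real.sqrt c) ^ 2 * D ^ 2 / (lam / 2) ^ 2)) := by
    apply Real.sqrt_le_sqrt
    have hsq : (u ⬝ᵥ u) ^ 2 ≤ D ^ 2 := pow_le_pow_left₀ huu0 huD 2
    have ha : (1 + lam ^ 2 / (lam / 2) ^ 2) * (u ⬝ᵥ u) ≤ (1 + lam ^ 2 / (lam / 2) ^ 2) * D := mul_le_mul_of_nonneg_left huD (by positivity)
    have hb' : (2 * K * c * Real.sqrt c) ^ 2 * (u ⬝ᵥ u) ^ 2 / (lam / 2) ^ 2 ≤ (2 * K * c * Real.sqrt c) ^ 2 * D ^ 2 / (lam / 2) ^ 2 :=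
      div_le_div_of_nonneg_right (mul_le_mul_of_nonneg_left hsq (by positivity)) (by positivity)
    linarith
  have h3 : (1 / 2) * (c * (c * K / (lam / 2)) *
        Real.sqrt (3 * ((1 + lam ^ 2 / (lam / 2) ^ 2) * (u ⬝ᵥ u) + (2 * K * c * Real.sqrt c) ^ 2 * (u ⬝ᵥ u) ^ 2 / (lam / 2) ^ 2))) ≤
      (1 / 2) * (c * (c * K / (lam / 2)) *
        Real.sqrt (3 * ((1 + lam ^ 2 / (lam / 2) ^ 2) * D + (2 * K * c * Real.sqrt c) ^ 2 * D ^ 2 / (lam / 2) ^ 2))) :=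
    mul_le_mul_of_nonneg_left (mul_le_mul_of_nonneg_left h2 (by positivity)) (by norm_num)
  have h4 : (1 / 2) * ((4 : ℕ) * (s / (s + lam))) ≤ (1 / 2) * (4 * (s' / (s' + lam))) := by
    push_cast
    exact mul_le_mul_of_nonneg_left (mul_le_mul_of_nonneg_left h1 (by norm_num)) (by norm_num)
  have h5 : (1 / 2) * (c - (4 : ℕ)) = (1 / 2) * (c - 4) := by push_cast; ring
  rw [h5] at key
  linarith [key, h3, h4]

end Summit.QuantumFields.YangMills.Theorems.VirialFluxGap.FrameHessian

end
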